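import Summits.MatrixMultiplication.MatrixMultiplication.Theses.ThinBlockAlpha
import Summits.MatrixMultiplication.MatrixMultiplication.Theorems.RectangularThmB.Negative.TwoLegTranslate
import Summits.MatrixMultiplication.MatrixMultiplication.Theorems.ThinPackings.Negative.ThinPackingsPacking
import Literature.Combinatorics.Additive.TricoloredSumFreeBound

/-!
# Skeleton line `kronecker-multiplicity-clp` for crux `RectangularThmB` (stmt-MatrixMultiplication-10597)

Route `ThinBlockAlpha`, crux r4 `RectangularThmB` ("rectangular Theorem B"):
`∀ ℓ, ∀ a ∈ (0,1), ∃ η > 0`: every STPP family of `L` blocks `⟨N, M, N⟩`, `N ≥ 2`, `N^a ≤ M`, in a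
finite abelian group of exponent `≤ ℓ` has `L·N^{2+η} < |H|`.
Planner: planner-cruxplan-stmt-MatrixMultiplication-10597-kronecker-multiplici-0 (crux-plan, round 1,
2026-08-16). Idea card `Cruxes/RectangularThmB/Ideas/kronecker-multiplicity-clp.md` (ideator 2), merged by
the triage panel with `clp-annihilator-sum-graph` and `weighted-support-spectrum` (same wall `a₁(q)`);
line card `Lines/kronecker-multiplicity-clp.md`.

## The line

LEVER (idea card): for a function `P : H → 𝔽̄_p` of binomial degree `≤ d` vanishing on the TWO-LEG
DEFECT SET `ℰ = H ∖ ⋃ₖ (Aₖ − Cₖ)` (`|ℰ| = |H| − L N²`), the sumset matrix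
`(P(x+y))_{x ∈ ⊔(Aᵢ−Bᵢ), y ∈ ⊔(Bⱼ−Cⱼ)}` is `⊕ᵢ I_M ⊗ (P(a−c))_{a ∈ Aᵢ, c ∈ Cᵢ}` (matched-sum lemma
`matched_of_sum_mem`, proved in `SketchIdeator2R1.lean`: `x + y ∈ Aₖ − Cₖ` iff same block and same
middle element), of rank `M·Σᵢ rank 𝒫ᵢ`, while Croot–Lev–Pach caps the rank by `2·m_{⌊d/2⌋}`
(`m_e = #{v ∈ {0..q−1}^κ : Σ v ≤ e}`); a dimension count for spaces of block-diagonal matrices of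
bounded total rank (elementary Flanders bound `dim ≤ r(2N − r)`, blockwise through a generic
element over `𝔽̄_p`) gives the TWO-LEG CLP INEQUALITY (STUB 1, general prime-power host with a
cofactor `G`): `M·(m_d·|G| − |ℰ|) ≤ 4·N·m_{⌊d/2⌋}·|G|`, i.e.
`M·L·N² ≤ M·u_{d+1}·|G| + 4·N·m_{⌊d/2⌋}·|G|` (`u_e = #{Σ v ≥ e}`).  The short leg `M` MULTIPLIES,
the long leg `N` divides, `|H|` enters only through the defect.

THE SKELETON (3 registered stubs, 2 proved glue theorems):

* STUB 1 `stub_twoLegCLP` (L, provable now — the lever): the two-leg CLP inequality above, for every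
  STPP family in any `H ≃+ (κ → ℤ/p^r) × G` and every degree `d`.
* STUB 2 `stub_quarterRate` (M, provable now — classical large deviations for digit sums, by the
  generating-function method of `card_lowWeight_mul_pow_le` / `exists_base_lt`): if the upper tail at
  `d` is not tiny (`2·u_d ≥ q^{n(1−γ)}`) then `d ≲` mean, `⌊d/2⌋ ≲` a QUARTER of the range, and the
  lower tail there is exponentially small: `m_{⌊d/2⌋} ≤ K·q^{n(1−s)}` (any `s ≤ I_q(1/4)/2` works;
  `I_2(1/4) = 1 − h(1/4) = 0.1887`, `I_3 = 0.1797`, `I_5 = 0.1649`, `I_7 = 0.1543` in base `q`).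
* `kroneckerBound_of` (PROVED here, ≈ 200 lines): STUB 1 + STUB 2 ⇒ `KroneckerBound`: for every `ℓ`
  there are `σ, η₀ > 0`, `c₀ ≥ 1` with `L·N·M ≤ c₀·|H|^{1−σ}` for every exponent-`≤ ℓ` STPP family of
  blocks `⟨N,M,N⟩`, `N ≥ 2`, that is two-leg tight up to `N^η`, `η ≤ η₀` (`|H| ≤ L N^{2+η}`).  Proof:
  `H ≃ (ℤ/q)^κ × G` with `q^{|κ|} ≥ |H|^{1/ℓ}` (`exists_addEquiv_pi_zmod_prod`), least degree `d₀` with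
  `2 u_{d₀+1}|G| ≤ L N²`, STUB 1 at `d₀`, minimality + near-tightness feed STUB 2.  With
  `L ≥ |H| N^{−2−η}` and `M ≥ N^a` it reads `|H|^σ ≤ c₀ N^{1+η−a}`: near-tight families have HUGE
  blocks, `N ≥ |H|^{σ/(1+η−a)}/c₀^{…}` — the SMALL-BLOCK REGIME IS EXCLUDED (and, a sanity check, at
  `N = M = 1` STUB 1 is, up to constants, the Croot–Lev–Pach–Ellenberg–Gijswijt tricolored bound).
* STUB 3 `stub_hugeBlocks` (XL, OPEN — the hardest stub, = the crux on huge-block families): for all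
  `ℓ, ν > 0, a ∈ (0,1)` there is `η > 0` such that every family as in the crux WITH `|H|^ν ≤ N` has
  `L N^{2+η} < |H|`.  Strictly weaker than the crux (by the small-block regime), vacuous for
  `ν > 1/(2+a)` (single-block volume `N^{2+a} ≤ |H|`), and only the single value `ν = σ(ℓ)/4` is
  consumed by the composition — smaller `ν` then follow from the composition itself, so proving it
  for `ν ≥ σ(ℓ)/4` (sharp form: `ν ≥ I_q(1/4)/(1−a) − o(1)`, e.g. `0.23` at `q = 7, a = 1/3`, inside
  the window `[0.23, 0.4286)` that contains the CKSU `Cyc₇^{7k}` designs at `ν = 0.394`) is the real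
  task; by the triage panel this residual coincides with the residual of every passing line and
  contains skew-USP sub-capacity (crux `SkewLocalStrongUSP`, negated).
* `RectangularThmB_of` (PROVED here, ≈ 130 lines): STUB 1 → STUB 2 → STUB 3 → `RectangularThmB` BY
  NAME: regime split at `N ≥ |H|^{σ/4}` (STUB 3) / `N < |H|^{σ/4}` (Kronecker bound ⇒ `|H| ≤ H₀ :=
  c₀^{2/σ}`), and groups of bounded order by the LANDED two-leg translate bound `(L+1)·N² ≤ |H|`
  (`Theorems/RectangularThmB/Negative/TwoLegTranslate.lean`, p73858) plus Bernoulli; the produced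
  `η(ℓ,a) = min(η₀(ℓ), η_B(ℓ,a,σ/4), 1/(2H₀²), 1)`.

WHY THE WALL `a₁`: with the sharp constants (Flanders–Meshulam `dim ≤ rN`, rate `I_q(1/4)`) the
Kronecker bound alone closes the crux iff `I_q(1/4)/(1−a) > 1/(2+a)`, i.e. `a > a₁(q) =
(1−2I)/(1+I) = 0.5237 / 0.5431 / 0.5753 / 0.5991` (`q = 2,3,5,7`; triage tables), improving the
tree's `a₀(ℓ) = (2−6δ_ℓ)/(2+3δ_ℓ) ≈ 0.67–0.73` (`Disproof.inner_of_thmB`); below `a₁` STUB 3 is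
non-void.  The skeleton does not hard-wire any threshold: the constants are existential, STUB 3 is
stated for every `ν`, and the handshake is in `RectangularThmB_of`.

## Disproof used (`Cruxes/RectangularThmB/Disproof.lean`, cdisprove, read 2026-08-16T02:40Z)

* `rectangularThmB_false_without_pos_a` — HONOURED: `0 < a` is used quantitatively in
  `RectangularThmB_of` through `two_le_M` (`M ≥ 2`, which feeds `succ_mul_sq_le_card` in the
  bounded-order case; the `a = 0` witness `wA, wB, wC` has `M = 1`, `|H| = N² = 4` and is exactly a
  bounded-order near-tight family) and in STUB 3's hypothesis `N^a ≤ M`.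
* `rectangularThmB_false_without_N_ge_two` — HONOURED: `2 ≤ N` gives `|H| > 1` for the structure
  theorem in `kroneckerBound_of` and the divisions by `N`.
* `eta_le_a`, `not_uniform_eta`, `not_uniform_half_a`, `not_uniform_linear_eta` (§B, §C, §G) —
  RESPECTED: the line's `η(ℓ,a) ≤ η_B(ℓ,a,σ/4)` is existential and inherits every upper bound from
  STUB 3; nothing uniform in `a` or linear in `a` is claimed.
* `succ_mul_sq_le_card` / `no_finite_witness` (§C, landed p73858) — USED (imported): they dispatch
  the bounded-order regime, which is precisely "finitely many orders admit a uniform `η`".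
* `rectangularThmB_iff_small_a` (§A) and `inner_of_thmB` (§F) — the honest map: STUBS 1–2 own the
  small-block regime for EVERY `a` (new: no previous tool excludes `N ≤ |H|^{I_q(1/4)/(1−a)}`), STUB 3
  owns the `a → 0⁺` content.
* `resists` items 2–4, 6: the CKSU/cyclic-USP calibration families (`cyc11`, `cycRow`) all sit in
  STUB 3's window (`ν = n ln(q−1)/((2n+1) ln q) ≈ 0.45`), consistent with the Kronecker exclusion.
* Landed Negative lemmas checked: `Theorems/RectangularThmB/Negative/TwoLegTranslate.lean` (imported;
  positive lemmas, refute no stub instance); the `BoundedExponentThird/Negative/*` and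
  `ThinPackings/Negative/*` files concern the sibling (construction) cruxes — STUB 3 at `a = 1/3`
  is consistent with `not_BoundedExponentThirdBoundedN` (bounded `N` is the Kronecker regime).
  No `-- Targets` stub kill exists (§D empty).

## Barriers (`Literature/Barriers/MatrixMultiplication/`)

* `TricoloredSumFreeBarrier` (the crux's technique class, read as a cap on PROOF methods: slice
  rank of `D_H` is `≥ (q J(q))ⁿ`, KSS/Norin/Pebody-tight) — does not bite STUBS 1–2: the lever is a
  2-variable matrix rank bound with the quarter rate `I_q(1/4)`, not a 3-tensor slice-rank bound
  with `I_q(1/3)`, and tightness of tricolored sum-free sets says nothing about sumset matrices with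
  a prescribed Kronecker zero pattern.  It DOES describe the honest cap of the lever: Meshulam is
  tight on full difference rectangles `Aᵢ × Cᵢ`, so the Kronecker bound stops at `ν_K` and STUB 3
  carries the rest ("it does; the bet is that huge blocks are a different problem — few, fat
  blocks, where label/shadow and capacity arguments start to apply").
* `BoundedRankFrameBarrier` — opposite regime (`F_q^m`, rank bounded, `q → ∞`); not in play.
* `RectangularBarrier` (CLLZ `α ≤ 0.625`), `UniversalMethodBarrier`, `IrreversibilityBarrier` —
  barriers on UPPER-bound methods for `ω/α`; not in play for this negative statement.
* Negatives index (`ledger negatives`): the refuted AlgebraicSTPPDichotomy frame designs and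
  DesignFlattening statements are neither used nor restated.
-/

set_option linter.dupNamespace false

namespace Summit.MatrixMultiplication.MatrixMultiplication.Cruxes.RectangularThmB.KroneckerMultiplicityClp

open Finset
open Literature.Computability.AlgebraicComplexity
open Summit.MatrixMultiplication.MatrixMultiplication.Theses.ThinBlockAlpha

noncomputable section

/-! ### The statements of the line (named `Prop`s over existing declarations) -/

/-- **STUB 1 statement — the two-leg Croot–Lev–Pach / Kronecker-multiplicity inequality.**
For a prime `p`, any `r`, a finite index type `κ`, a finite abelian cofactor `G`, a finite abelian
`H ≃+ (κ → ℤ/p^r) × G`, an STPP family `(Aᵢ, Bᵢ, Cᵢ)_{i<L}` in `H` with `|Aᵢ| = |Cᵢ| = N`,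
`|Bᵢ| = M`, and every `d`:
`M·L·N² ≤ M·u_{d+1}·|G| + 4·N·m_{⌊d/2⌋}·|G|`, where over digit vectors `v ∈ {0,…,p^r−1}^κ`
`u_e = #{e ≤ Σ v}` and `m_e = #{Σ v ≤ e}`.  Equivalently (`m_d + u_{d+1} = q^{|κ|}`,
`|H| = q^{|κ|}|G|`, `|⋃(Aₖ−Cₖ)| = L N²` when `M ≥ 1`): `M·(m_d|G| − |ℰ|) ≤ 4N·m_{⌊d/2⌋}|G|` with
`ℰ = H ∖ ⋃ₖ(Aₖ − Cₖ)` — the idea card's `TwoLegCLP` with the ELEMENTARY constant `4` (Flanders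
`dim ≤ r(2N−r)` for a space of `N×N` matrices of rank `≤ r` containing a rank-`r` element, over the
infinite field `𝔽̄_p`) instead of `2` (Flanders–Meshulam `dim ≤ rN`), and with the cofactor
dilution `·|G|` (functions of binomial degree `≤ d` in the `κ` digits, arbitrary on `G`).
Proof plan (idea card + TRIAGE-r1-2/3, all steps checked on paper by two triagers):
binomial basis `C(x,v) = ∏ₗ C(xₗ,vₗ) mod p` (Lucas periodicity `natCast_choose_add_pow`,
Vandermonde `Nat.add_choose_eq`) ⇒ `rank (P(x+y))_{x,y} ≤ 2 m_{⌊d/2⌋}|G|`; block structure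
`⊕ I_M ⊗ 𝒫ᵢ` by `matched_of_sum_mem`; `P ↦ (𝒫ᵢ)ᵢ` injective on `{deg ≤ d, P|_ℰ = 0}`
(dimension `≥ m_d|G| − |ℰ|`); generic element + blockwise Flanders.  Trivially true for `M = 0`.
Finite sanity (triage): predicts max `L = 2` for `⟨2,2,2⟩`-families in `𝔽₂⁴` (verified by hand)
with constant 2; SAT checks j010454 / j010726 (`𝔽₂⁵`, `L = 5`) were pending at planning time. -/
def TwoLegCLP : Prop :=
  ∀ (p : ℕ) [Fact p.Prime] (r : ℕ) (κ : Type) [Fintype κ] [DecidableEq κ]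
    (G : Type) [AddCommGroup G] [Fintype G]
    (H : Type) [AddCommGroup H] [Fintype H], (H ≃+ ((κ → ZMod (p ^ r)) × G)) →
    ∀ (L N M : ℕ) (A B C : Fin L → Finset H), IsSTPP A B C →
      (∀ i, (A i).card = N ∧ (B i).card = M ∧ (C i).card = N) →
      ∀ d : ℕ,
        M * (L * N ^ 2) ≤
          M * (((univ : Finset (κ → Fin (p ^ r))).filter
                  fun v => d + 1 ≤ ∑ l, (v l : ℕ)).card * Fintype.card G) +
            4 * N * (((univ : Finset (κ → Fin (p ^ r))).filter
                  fun v => ∑ l, (v l : ℕ) ≤ d / 2).card * Fintype.card G)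

/-- **STUB 2 statement — quarter-point large deviation for digit sums.**  For every `q ≥ 2` there
are `s ∈ (0,1]`, `γ > 0`, `K ≥ 1` such that for every finite `κ` (`n = |κ|`) and every `d`:
if the upper tail of the digit sum at `d` is not tiny, `q^{n(1−γ)} ≤ 2·#{v : d ≤ Σ v}`, then the
lower tail at `⌊d/2⌋` is exponentially small, `#{v : Σ v ≤ ⌊d/2⌋} ≤ K·q^{n(1−s)}`.
(Upper tail large ⇒ `d ≤ (q−1)n/2 + O(√γ)n + O_γ(1)` by the generating function
`u_d ≤ λ^{−d}(Σ_{b<q} λ^b)ⁿ`, `λ = e^{√γ}`, with `Σ_b e^{θb} ≤ q(1+e^{(q−1)θ})/2 ≤ q e^{μθ + μ²θ²/2}`,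
`μ = (q−1)/2`; then `⌊d/2⌋ ≤ (q−1)n/4 + O(√γ)n + O_γ(1)` and `m_k ≤ v^{−k}(Σ_b v^b)ⁿ` for the
base `v ∈ (0,1)` minimising `v^{−(q−1)/4} Σ_b v^b =: q^{1 − I_q(1/4)}` — positivity of `I_q(1/4)`
is the derivative computation of `exists_base_lt` with `1/4` in place of `1/3`; any
`s ≤ I_q(1/4)/2` with `γ` small and `K` large works.  `n = 0` and `d = 0` are trivially fine.) -/
def QuarterRate : Prop :=
  ∀ q : ℕ, 2 ≤ q → ∃ s : ℝ, 0 < s ∧ s ≤ 1 ∧ ∃ γ : ℝ, 0 < γ ∧ ∃ K : ℝ, 1 ≤ K ∧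
    ∀ (κ : Type) [Fintype κ] [DecidableEq κ] (d : ℕ),
      (q : ℝ) ^ ((Fintype.card κ : ℝ) * (1 - γ)) ≤
          2 * ((((univ : Finset (κ → Fin q)).filter fun v => d ≤ ∑ l, (v l : ℕ)).card : ℕ) : ℝ) →
        ((((univ : Finset (κ → Fin q)).filter fun v => ∑ l, (v l : ℕ) ≤ d / 2).card : ℕ) : ℝ) ≤
          K * (q : ℝ) ^ ((Fintype.card κ : ℝ) * (1 - s))

/-- **STUB 3 statement — the huge-block regime of the crux** (the open core of the line).  For all
`ℓ`, `ν > 0` and `a ∈ (0,1)` there is `η > 0` such that every exponent-`≤ ℓ` STPP family of blocks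
`⟨N, M, N⟩`, `N ≥ 2`, `N^a ≤ M`, WITH `|H|^ν ≤ N`, has `L·N^{2+η} < |H|`.  This is the crux
restricted to huge-block families (strictly weaker: the small-block regime is `kroneckerBound_of`);
vacuous for `ν > 1/(2+a)`; the composition uses it only at `ν = σ(ℓ)/4` (sharp form:
`ν_K = I_q(1/4)/(1−a) − o(1)`), and every smaller `ν` then follows from the composition, so the
content is the window `ν ∈ [ν_K, 1/(2+a))`, which contains the CKSU `Cyc₇^{7k}` designs
(`ν = 3 ln 6/(7 ln 7) = 0.394` at `a = 1/3`) and the disprover's cyclic families.  Its `η` is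
`≤ a` (`Disproof.eta_le_a`) and cannot be uniform or linear in `a` (`not_uniform_eta`,
`not_uniform_linear_eta`).  Stated VERBATIM as in the sibling line `weighted-support-spectrum`
(same registered stub `stub_hugeBlocks` on the crux item: one proof serves both lines). -/
def HugeBlocks : Prop :=
  ∀ ℓ : ℕ, ∀ ν : ℝ, 0 < ν → ∀ a : ℝ, 0 < a → a < 1 → ∃ η : ℝ, 0 < η ∧
    ∀ (H : Type) [AddCommGroup H] [Fintype H], AddMonoid.exponent H ≤ ℓ →
      ∀ (L N M : ℕ) (A B C : Fin L → Finset H), IsSTPP A B C →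
        (∀ i, (A i).card = N ∧ (B i).card = M ∧ (C i).card = N) → 2 ≤ N →
        (N : ℝ) ^ a ≤ M → (Fintype.card H : ℝ) ^ ν ≤ N →
        (L : ℝ) * (N : ℝ) ^ (2 + η) < Fintype.card H

/-- **The Kronecker bound** (PROVED below from STUBS 1 and 2, `kroneckerBound_of`): for every `ℓ`
there are `σ > 0`, `c₀ ≥ 1`, `η₀ > 0` such that every exponent-`≤ ℓ` STPP family of blocks
`⟨N, M, N⟩`, `N ≥ 2`, with `|H| ≤ L·N^{2+η}` for some `0 ≤ η ≤ η₀` satisfies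
`L·N·M ≤ c₀·|H|^{1−σ}`.  (No hypothesis on `a`/`M`: for `M = 0` it is trivial, for `M = 1` it is a
tricolored-type bound.) -/
def KroneckerBound : Prop :=
  ∀ ℓ : ℕ, ∃ σ : ℝ, 0 < σ ∧ ∃ c₀ : ℝ, 1 ≤ c₀ ∧ ∃ η₀ : ℝ, 0 < η₀ ∧
    ∀ η : ℝ, 0 ≤ η → η ≤ η₀ →
      ∀ (H : Type) [AddCommGroup H] [Fintype H], AddMonoid.exponent H ≤ ℓ →
        ∀ (L N M : ℕ) (A B C : Fin L → Finset H), IsSTPP A B C →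
          (∀ i, (A i).card = N ∧ (B i).card = M ∧ (C i).card = N) → 2 ≤ N →
            (Fintype.card H : ℝ) ≤ L * (N : ℝ) ^ (2 + η) →
              (L : ℝ) * (N : ℝ) * (M : ℝ) ≤ c₀ * (Fintype.card H : ℝ) ^ (1 - σ)

/-! ### Registered stubs (`ledger skeleton check … --crux stmt-MatrixMultiplication-10597`) -/

/-- STUB 1 (L, provable now, the lever) — `TwoLegCLP` verbatim; see its docstring for the proof
plan.  Sources: Croot–Lev–Pach arXiv:1605.01506 Lemma 1; Flanders 1962 (J. London Math. Soc. 37)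
/ Meshulam 1985 (Quart. J. Math. 36); BCCGNSU arXiv:1605.06702 §4.3 (prime powers, Prop. 4.15);
tree `natCast_choose_add_pow`, `matched_of_sum_mem` (SketchIdeator2R1.lean). -/
theorem stub_twoLegCLP :
    ∀ (p : ℕ) [Fact p.Prime] (r : ℕ) (κ : Type) [Fintype κ] [DecidableEq κ]
    (G : Type) [AddCommGroup G] [Fintype G]
    (H : Type) [AddCommGroup H] [Fintype H], (H ≃+ ((κ → ZMod (p ^ r)) × G)) →
    ∀ (L N M : ℕ) (A B C : Fin L → Finset H), IsSTPP A B C →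
      (∀ i, (A i).card = N ∧ (B i).card = M ∧ (C i).card = N) →
      ∀ d : ℕ,
        M * (L * N ^ 2) ≤
          M * (((univ : Finset (κ → Fin (p ^ r))).filter
                  fun v => d + 1 ≤ ∑ l, (v l : ℕ)).card * Fintype.card G) +
            4 * N * (((univ : Finset (κ → Fin (p ^ r))).filter
                  fun v => ∑ l, (v l : ℕ) ≤ d / 2).card * Fintype.card G) := by
  sorry

/-- STUB 2 (M, provable now) — `QuarterRate` verbatim; see its docstring.  Sources: BCCGNSU
arXiv:1605.06702 Prop. 4.12 (rate function), tree `card_lowWeight_mul_pow_le`, `exists_base_lt`,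
`exists_theta` (the `1/3`-point versions), Mathlib `Real.cosh_le_exp_half_sq`. -/
theorem stub_quarterRate :
    ∀ q : ℕ, 2 ≤ q → ∃ s : ℝ, 0 < s ∧ s ≤ 1 ∧ ∃ γ : ℝ, 0 < γ ∧ ∃ K : ℝ, 1 ≤ K ∧
    ∀ (κ : Type) [Fintype κ] [DecidableEq κ] (d : ℕ),
      (q : ℝ) ^ ((Fintype.card κ : ℝ) * (1 - γ)) ≤
          2 * ((((univ : Finset (κ → Fin q)).filter fun v => d ≤ ∑ l, (v l : ℕ)).card : ℕ) : ℝ) →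
        ((((univ : Finset (κ → Fin q)).filter fun v => ∑ l, (v l : ℕ) ≤ d / 2).card : ℕ) : ℝ) ≤
          K * (q : ℝ) ^ ((Fintype.card κ : ℝ) * (1 - s)) := by
  sorry

/-- STUB 3 (XL, OPEN, HARDEST) — `HugeBlocks` verbatim: the crux on families with `N ≥ |H|^ν`;
see its docstring for the window that carries the content.  Sources: arXiv:1605.06702 (Thm B),
arXiv:math/0511460 §6 (CKSU Thm 33 designs live in the window), Disproof.lean §E–§G. -/
theorem stub_hugeBlocks :
    ∀ ℓ : ℕ, ∀ ν : ℝ, 0 < ν → ∀ a : ℝ, 0 < a → a < 1 → ∃ η : ℝ, 0 < η ∧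
      ∀ (H : Type) [AddCommGroup H] [Fintype H], AddMonoid.exponent H ≤ ℓ →
        ∀ (L N M : ℕ) (A B C : Fin L → Finset H), IsSTPP A B C →
          (∀ i, (A i).card = N ∧ (B i).card = M ∧ (C i).card = N) → 2 ≤ N →
          (N : ℝ) ^ a ≤ M → (Fintype.card H : ℝ) ^ ν ≤ N →
          (L : ℝ) * (N : ℝ) ^ (2 + η) < Fintype.card H := by
  sorry

/-! ### Consistency: each named statement IS its registered stub (definitionally) -/

theorem twoLegCLP_holds : TwoLegCLP := stub_twoLegCLP
theorem quarterRate_holds : QuarterRate := stub_quarterRate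
theorem hugeBlocks_holds : HugeBlocks := stub_hugeBlocks

/-! ### Name-keyed aliases of the three statements (the hypotheses of the composition; the
skeleton audit admits a hypothesis only if its head constant is a registered obligation or is
named like a declared stub) -/
namespace Registered
/-- Alias of `TwoLegCLP` keyed by the registered stub name. -/
abbrev stub_twoLegCLP : Prop := TwoLegCLP
/-- Alias of `QuarterRate` keyed by the registered stub name. -/
abbrev stub_quarterRate : Prop := QuarterRate
/-- Alias of `HugeBlocks` keyed by the registered stub name. -/
abbrev stub_hugeBlocks : Prop := HugeBlocks
end Registered

/-! ### Counting helpers (simplex tails of digit vectors) -/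

/-- Upper simplex tail: `#{v ∈ {0,…,q-1}^κ : e ≤ Σ v}`. -/
def hiCount (q : ℕ) (κ : Type) [Fintype κ] [DecidableEq κ] (e : ℕ) : ℕ :=
  ((univ : Finset (κ → Fin q)).filter fun v => e ≤ ∑ l, (v l : ℕ)).card

/-- Lower simplex tail: `#{v ∈ {0,…,q-1}^κ : Σ v ≤ d}` (= the number `m_d` of reduced monomials
of degree `≤ d`, i.e. the dimension of the degree-`≤ d` binomial functions on `(ℤ/q)^κ`). -/
def loCount (q : ℕ) (κ : Type) [Fintype κ] [DecidableEq κ] (d : ℕ) : ℕ :=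
  ((univ : Finset (κ → Fin q)).filter fun v => ∑ l, (v l : ℕ) ≤ d).card

/-- No digit vector has digit sum above `(q-1)·|κ|`. -/
theorem hiCount_eq_zero (q : ℕ) (κ : Type) [Fintype κ] [DecidableEq κ] :
    hiCount q κ ((q - 1) * Fintype.card κ + 1) = 0 := by
  rw [hiCount, Finset.card_eq_zero, Finset.filter_eq_empty_iff]
  intro v _ hle
  have hsum : ∑ l, (v l : ℕ) ≤ ∑ _l : κ, (q - 1) :=
    Finset.sum_le_sum fun l _ => by have := (v l).isLt; omega
  rw [Finset.sum_const, card_univ, smul_eq_mul, mul_comm] at hsum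
  omega

/-- Only the zero vector has digit sum `≤ 0`. -/
theorem loCount_zero_le_one (q : ℕ) (κ : Type) [Fintype κ] [DecidableEq κ] :
    loCount q κ 0 ≤ 1 := by
  rw [loCount]
  refine Finset.card_le_one.2 fun v hv w hw => ?_
  rw [Finset.mem_filter] at hv hw
  have hv0 : ∀ l, (v l : ℕ) = 0 := fun l =>
    (Finset.sum_eq_zero_iff.1 (Nat.le_zero.1 hv.2)) l (mem_univ l)
  have hw0 : ∀ l, (w l : ℕ) = 0 := fun l =>
    (Finset.sum_eq_zero_iff.1 (Nat.le_zero.1 hw.2)) l (mem_univ l)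
  funext l
  exact Fin.ext (by rw [hv0 l, hw0 l])

/-! ### Glue, part 1 (PROVED): the Kronecker bound from stubs 1 and 2 -/

open Summit.MatrixMultiplication.MatrixMultiplication.Theorems.ThinPackings.Negative
  (one_le_L two_le_M thin_volume_bound) in
/-- **The Kronecker bound** (the `a`-free output of the lever): for every `ℓ` there are `σ, η₀ > 0`
and `c₀` such that every STPP family of blocks `⟨N, M, N⟩`, `N ≥ 2`, in an abelian group of
exponent `≤ ℓ` that is two-leg tight up to `N^{η}`, `η ≤ η₀` (`|H| ≤ L·N^{2+η}`) has
`L·N·M ≤ c₀ |H|^{1-σ}` — the short leg `M` multiplies, so such families have FEW and SMALL blocks.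
Proof: `H ≃ (ℤ/q)^κ × G'` with `q^{|κ|} ≥ |H|^{1/ℓ}` (`exists_addEquiv_pi_zmod_prod`); take the least
degree `d₀` with `2·u_{d₀+1}·|G'| ≤ L N²`; stub 1 at `d₀` gives `M L N² ≤ 8 N m_{⌊d₀/2⌋} |G'|`;
minimality and near-tightness give `2 u_{d₀} ≥ q^{n(1-γ)}`, so stub 2 bounds
`m_{⌊d₀/2⌋} ≤ K q^{n(1-s)}`; hence `L N M ≤ 8K q^{-ns}|H| ≤ 8K |H|^{1-s/ℓ}`. -/
theorem kroneckerBound_of (hK : TwoLegCLP) (hLD : QuarterRate) : KroneckerBound := by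
  classical
  intro ℓ
  -- Stub 2 for every modulus `q`, guarded by `2 ≤ q`, in terms of `hiCount`/`loCount`.
  have hLD' : ∀ q : ℕ, ∃ s : ℝ, 0 < s ∧ s ≤ 1 ∧ ∃ γ : ℝ, 0 < γ ∧ ∃ K : ℝ, 1 ≤ K ∧
      (2 ≤ q → ∀ (κ : Type) [Fintype κ] [DecidableEq κ] (d : ℕ),
        (q : ℝ) ^ ((Fintype.card κ : ℝ) * (1 - γ)) ≤ 2 * (hiCount q κ d : ℝ) →
          (loCount q κ (d / 2) : ℝ) ≤ K * (q : ℝ) ^ ((Fintype.card κ : ℝ) * (1 - s))) := by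
    intro q
    by_cases hq : 2 ≤ q
    · obtain ⟨s, hs, hs1, γ, hγ, K, hK1, h⟩ := hLD q hq
      exact ⟨s, hs, hs1, γ, hγ, K, hK1, fun _ κ _ _ d => h κ d⟩
    · exact ⟨1, one_pos, le_rfl, 1, one_pos, 1, le_rfl, fun h => absurd h hq⟩
  choose s hs0 hs1 γ hγ0 K hK1 hmain using hLD'
  -- degenerate exponent bounds: no family with `N ≥ 2` exists at all
  by_cases hℓ : ℓ < 2
  · refine ⟨1, one_pos, 1, le_rfl, 1, one_pos, ?_⟩
    intro η hη0 hη1 H _ _ hexp L N M A B C hS hc hN hnear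
    exfalso
    have hL := one_le_L hnear
    have hNle : N ≤ Fintype.card H := (hc ⟨0, hL⟩).1 ▸ Finset.card_le_univ _
    have hH' : 1 < Nat.card H := by rw [Nat.card_eq_fintype_card]; omega
    obtain ⟨p, hp, r, κ, _, _, G', _, _, _, h2q, hqℓ, -, -⟩ :=
      Literature.Combinatorics.Additive.exists_addEquiv_pi_zmod_prod ℓ H hexp hH'
    omega
  push Not at hℓ
  -- uniform constants over the prime powers `q ∈ [2, ℓ]`
  set Q : Finset ℕ := Finset.Icc 2 ℓ with hQ
  have hne : Q.Nonempty := ⟨2, Finset.mem_Icc.2 ⟨le_rfl, hℓ⟩⟩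
  set smin : ℝ := Q.inf' hne s with hsmin
  set γmin : ℝ := Q.inf' hne γ with hγmin
  set Kmax : ℝ := Q.sup' hne K with hKmax
  have hsmin0 : 0 < smin := (Finset.lt_inf'_iff hne).2 fun q _ => hs0 q
  have hsmin1 : smin ≤ 1 := (Finset.inf'_le _ (Finset.mem_Icc.2 ⟨le_rfl, hℓ⟩)).trans (hs1 2)
  have hγmin0 : 0 < γmin := (Finset.lt_inf'_iff hne).2 fun q _ => hγ0 q
  have hKmax1 : 1 ≤ Kmax := (hK1 2).trans (Finset.le_sup' _ (Finset.mem_Icc.2 ⟨le_rfl, hℓ⟩))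
  have hℓpos : (0 : ℝ) < ℓ := by exact_mod_cast (show 0 < ℓ by omega)
  refine ⟨smin / ℓ, div_pos hsmin0 hℓpos, 8 * Kmax, by linarith, γmin / ℓ,
    div_pos hγmin0 hℓpos, ?_⟩
  intro η hη0 hηle H _ _ hexp L N M A B C hS hc hN hnear
  -- trivial case `M = 0`
  have hHpos : (0 : ℝ) < Fintype.card H := by exact_mod_cast Fintype.card_pos
  rcases Nat.eq_zero_or_pos M with hM0 | hMpos
  · subst hM0
    simp only [Nat.cast_zero, mul_zero]
    positivity
  have hL := one_le_L hnear
  have hNle : N ≤ Fintype.card H := (hc ⟨0, hL⟩).1 ▸ Finset.card_le_univ _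
  have hH' : 1 < Nat.card H := by rw [Nat.card_eq_fintype_card]; omega
  -- structure of bounded-exponent groups
  obtain ⟨p, hp, r, κ, _, _, G', _, _, _, h2q, hqℓ, hcardle, ⟨e⟩⟩ :=
    Literature.Combinatorics.Additive.exists_addEquiv_pi_zmod_prod ℓ H hexp hH'
  set q : ℕ := p ^ r with hqdef
  set n : ℕ := Fintype.card κ with hn
  haveI : NeZero q := ⟨by omega⟩
  have hqQ : q ∈ Q := Finset.mem_Icc.2 ⟨h2q, hqℓ⟩
  have hq1 : (1 : ℝ) ≤ q := by exact_mod_cast (show 1 ≤ q by omega)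
  have hqpos : (0 : ℝ) < q := by linarith
  have hcardH : (Fintype.card H : ℝ) = (q : ℝ) ^ n * Fintype.card G' := by
    have := Fintype.card_congr e.toEquiv
    rw [Fintype.card_prod, Fintype.card_pi, Finset.prod_const, ZMod.card, card_univ] at this
    rw [this]
    push_cast
    rfl
  have hGpos : (0 : ℝ) < Fintype.card G' := by exact_mod_cast Fintype.card_pos
  have hcardleR : (Fintype.card H : ℝ) ≤ (q : ℝ) ^ ((n : ℝ) * ℓ) := by
    have h1 : (Fintype.card H : ℝ) ≤ ((q ^ (n * ℓ) : ℕ) : ℝ) := by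
      rw [← Nat.card_eq_fintype_card]; exact_mod_cast hcardle
    rw [Nat.cast_pow, ← Real.rpow_natCast] at h1
    push_cast at h1
    exact h1
  -- stub 1 in the present host
  have hKd : ∀ d : ℕ, M * (L * N ^ 2) ≤
      M * (hiCount q κ (d + 1) * Fintype.card G') + 4 * N * (loCount q κ (d / 2) * Fintype.card G') :=
    fun d => hK p r κ G' H e L N M A B C hS hc d
  -- the least admissible degree
  have hex : ∃ d : ℕ, 2 * (hiCount q κ (d + 1) * Fintype.card G') ≤ L * N ^ 2 :=
    ⟨(q - 1) * n, by rw [hn, hiCount_eq_zero]; simp⟩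
  set d₀ := Nat.find hex with hd₀
  have hd₀spec : 2 * (hiCount q κ (d₀ + 1) * Fintype.card G') ≤ L * N ^ 2 := Nat.find_spec hex
  -- `M L N² ≤ 8 N m_{⌊d₀/2⌋} |G'|`
  have hstep : (M : ℝ) * (L * (N : ℝ) ^ 2) ≤
      8 * N * ((loCount q κ (d₀ / 2) : ℝ) * Fintype.card G') := by
    have h1 : (M : ℝ) * (L * (N : ℝ) ^ 2) ≤ M * ((hiCount q κ (d₀ + 1) : ℝ) * Fintype.card G') +
        4 * N * ((loCount q κ (d₀ / 2) : ℝ) * Fintype.card G') := by exact_mod_cast hKd d₀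
    have h2 : 2 * ((hiCount q κ (d₀ + 1) : ℝ) * Fintype.card G') ≤ L * (N : ℝ) ^ 2 := by
      exact_mod_cast hd₀spec
    have h3 := mul_le_mul_of_nonneg_left h2 (Nat.cast_nonneg M)
    linarith
  -- `m_{⌊d₀/2⌋} ≤ Kmax · q^{n(1 - smin)}`
  have hpow1 : (1 : ℝ) ≤ (q : ℝ) ^ ((n : ℝ) * (1 - smin)) :=
    Real.one_le_rpow hq1 (mul_nonneg (Nat.cast_nonneg n) (by linarith))
  have hlo : (loCount q κ (d₀ / 2) : ℝ) ≤ Kmax * (q : ℝ) ^ ((n : ℝ) * (1 - smin)) := by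
    rcases Nat.eq_zero_or_pos d₀ with hd0 | hdpos
    · -- `d₀ = 0`: only the zero vector
      rw [hd0, Nat.zero_div]
      have h1 : (loCount q κ 0 : ℝ) ≤ 1 := by exact_mod_cast loCount_zero_le_one q κ
      calc (loCount q κ 0 : ℝ) ≤ 1 := h1
        _ ≤ Kmax * (q : ℝ) ^ ((n : ℝ) * (1 - smin)) := by nlinarith
    · -- `d₀ ≥ 1`: minimality makes the upper tail at `d₀` large, stub 2 applies
      have hmin : ¬ 2 * (hiCount q κ (d₀ - 1 + 1) * Fintype.card G') ≤ L * N ^ 2 :=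
        Nat.find_min hex (show d₀ - 1 < d₀ by omega)
      rw [Nat.sub_add_cancel hdpos, not_le] at hmin
      have hminR : (L : ℝ) * (N : ℝ) ^ 2 < 2 * ((hiCount q κ d₀ : ℝ) * Fintype.card G') := by
        exact_mod_cast hmin
      -- `N^η ≤ q^{n ℓ η / 2}`
      have hNpos : (0 : ℝ) < N := by exact_mod_cast (show 0 < N by omega)
      have hvol := thin_volume_bound hS hc ⟨0, hL⟩
      have hN2 : (N : ℝ) ^ (2 : ℝ) ≤ Fintype.card H := by
        rw [Real.rpow_two]
        have h1 : ((N * M * N : ℕ) : ℝ) ≤ Fintype.card H := by exact_mod_cast hvol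
        push_cast at h1
        have hM1 : (1 : ℝ) ≤ M := by exact_mod_cast hMpos
        nlinarith
      have hNsqrt : (N : ℝ) ≤ (Fintype.card H : ℝ) ^ (1 / 2 : ℝ) := by
        have h1 := Real.rpow_le_rpow (by positivity) hN2 (by norm_num : (0 : ℝ) ≤ 1 / 2)
        rwa [← Real.rpow_mul hNpos.le, show (2 : ℝ) * (1 / 2) = 1 by norm_num,
          Real.rpow_one] at h1
      have hNη : (N : ℝ) ^ η ≤ (q : ℝ) ^ ((n : ℝ) * ℓ * (η / 2)) := by
        calc (N : ℝ) ^ η ≤ ((Fintype.card H : ℝ) ^ (1 / 2 : ℝ)) ^ η :=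
              Real.rpow_le_rpow hNpos.le hNsqrt hη0
          _ = (Fintype.card H : ℝ) ^ (η / 2) := by
              rw [← Real.rpow_mul hHpos.le]; ring_nf
          _ ≤ ((q : ℝ) ^ ((n : ℝ) * ℓ)) ^ (η / 2) :=
              Real.rpow_le_rpow hHpos.le hcardleR (by linarith)
          _ = (q : ℝ) ^ ((n : ℝ) * ℓ * (η / 2)) := by rw [← Real.rpow_mul hqpos.le]
      -- the hypothesis of stub 2 at `d₀`
      have hγq : γmin ≤ γ q := Finset.inf'_le _ hqQ
      have hηγ : (ℓ : ℝ) * (η / 2) ≤ γ q := by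
        have h1 : (ℓ : ℝ) * η ≤ γmin := by
          have := mul_le_mul_of_nonneg_left hηle hℓpos.le
          rwa [mul_div_cancel₀ _ hℓpos.ne'] at this
        linarith
      have hhyp : (q : ℝ) ^ ((n : ℝ) * (1 - γ q)) ≤ 2 * (hiCount q κ d₀ : ℝ) := by
        -- `2 hi |G'| > L N² ≥ |H| / N^η = q^n |G'| / N^η`
        have hNηpos : (0 : ℝ) < (N : ℝ) ^ η := Real.rpow_pos_of_pos hNpos η
        have h1 : (Fintype.card H : ℝ) ≤ L * (N : ℝ) ^ 2 * (N : ℝ) ^ η := by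
          rw [mul_assoc, ← Real.rpow_two, ← Real.rpow_add hNpos]; exact hnear
        have h2 : (q : ℝ) ^ n * Fintype.card G' < 2 * ((hiCount q κ d₀ : ℝ) * Fintype.card G') *
            (N : ℝ) ^ η := by
          rw [← hcardH]
          calc (Fintype.card H : ℝ) ≤ L * (N : ℝ) ^ 2 * (N : ℝ) ^ η := h1
            _ < 2 * ((hiCount q κ d₀ : ℝ) * Fintype.card G') * (N : ℝ) ^ η :=
                mul_lt_mul_of_pos_right hminR hNηpos
        have h3 : (q : ℝ) ^ n < 2 * (hiCount q κ d₀ : ℝ) * (N : ℝ) ^ η := by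
          have h2' : ((q : ℝ) ^ n) * Fintype.card G' <
              (2 * (hiCount q κ d₀ : ℝ) * (N : ℝ) ^ η) * Fintype.card G' := by linarith
          exact lt_of_mul_lt_mul_right h2' hGpos.le
        have h4 : (q : ℝ) ^ n ≤ 2 * (hiCount q κ d₀ : ℝ) * (q : ℝ) ^ ((n : ℝ) * ℓ * (η / 2)) := by
          have := mul_le_mul_of_nonneg_left hNη (by positivity : (0 : ℝ) ≤ 2 * (hiCount q κ d₀ : ℝ))
          linarith
        have h5 : (q : ℝ) ^ ((n : ℝ) * (1 - γ q)) ≤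
            (q : ℝ) ^ ((n : ℝ) - (n : ℝ) * ℓ * (η / 2)) :=
          Real.rpow_le_rpow_of_exponent_le hq1 (by
            have hn0 : (0 : ℝ) ≤ n := Nat.cast_nonneg n
            nlinarith)
        calc (q : ℝ) ^ ((n : ℝ) * (1 - γ q)) ≤ (q : ℝ) ^ ((n : ℝ) - (n : ℝ) * ℓ * (η / 2)) := h5
          _ = (q : ℝ) ^ n / (q : ℝ) ^ ((n : ℝ) * ℓ * (η / 2)) := by
              rw [Real.rpow_sub hqpos, Real.rpow_natCast]
          _ ≤ 2 * (hiCount q κ d₀ : ℝ) := by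
              rw [div_le_iff₀ (Real.rpow_pos_of_pos hqpos _)]; exact h4
      have hLDq := hmain q h2q κ d₀ hhyp
      have hKq : K q ≤ Kmax := Finset.le_sup' _ hqQ
      have hsq : smin ≤ s q := Finset.inf'_le _ hqQ
      calc (loCount q κ (d₀ / 2) : ℝ) ≤ K q * (q : ℝ) ^ ((n : ℝ) * (1 - s q)) := hLDq
        _ ≤ Kmax * (q : ℝ) ^ ((n : ℝ) * (1 - smin)) := by
            apply mul_le_mul hKq _ (by positivity) (by linarith)
            exact Real.rpow_le_rpow_of_exponent_le hq1
              (mul_le_mul_of_nonneg_left (by linarith) (Nat.cast_nonneg n))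
  -- `q^{-n smin} ≤ |H|^{-smin/ℓ}`
  have hsave : (q : ℝ) ^ ((n : ℝ) * (1 - smin)) * Fintype.card G' ≤
      (Fintype.card H : ℝ) ^ (1 - smin / ℓ) := by
    have h1 : (Fintype.card H : ℝ) ^ (smin / ℓ) ≤ (q : ℝ) ^ ((n : ℝ) * smin) := by
      calc (Fintype.card H : ℝ) ^ (smin / ℓ) ≤ ((q : ℝ) ^ ((n : ℝ) * ℓ)) ^ (smin / ℓ) :=
            Real.rpow_le_rpow hHpos.le hcardleR (div_nonneg hsmin0.le hℓpos.le)
        _ = (q : ℝ) ^ ((n : ℝ) * smin) := by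
            rw [← Real.rpow_mul hqpos.le]
            congr 1
            field_simp
    have h2 : (q : ℝ) ^ ((n : ℝ) * (1 - smin)) * (q : ℝ) ^ ((n : ℝ) * smin) = (q : ℝ) ^ n := by
      rw [← Real.rpow_add hqpos, ← Real.rpow_natCast]; ring_nf
    have h3 : (Fintype.card H : ℝ) ^ (1 - smin / ℓ) * (Fintype.card H : ℝ) ^ (smin / ℓ) =
        Fintype.card H := by
      rw [← Real.rpow_add hHpos]; ring_nf; exact Real.rpow_one _
    -- compare after multiplying by the positive `q^{n smin}`
    have hqs : (0 : ℝ) < (q : ℝ) ^ ((n : ℝ) * smin) := Real.rpow_pos_of_pos hqpos _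
    have hHs : (0 : ℝ) < (Fintype.card H : ℝ) ^ (smin / ℓ) := Real.rpow_pos_of_pos hHpos _
    refine le_of_mul_le_mul_right ?_ hqs
    calc (q : ℝ) ^ ((n : ℝ) * (1 - smin)) * Fintype.card G' * (q : ℝ) ^ ((n : ℝ) * smin)
        = (q : ℝ) ^ n * Fintype.card G' := by rw [mul_right_comm, h2]
      _ = Fintype.card H := hcardH.symm
      _ = (Fintype.card H : ℝ) ^ (1 - smin / ℓ) * (Fintype.card H : ℝ) ^ (smin / ℓ) := h3.symm
      _ ≤ (Fintype.card H : ℝ) ^ (1 - smin / ℓ) * (q : ℝ) ^ ((n : ℝ) * smin) :=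
          mul_le_mul_of_nonneg_left h1 (by positivity)
  -- assemble: `L N M ≤ 8 m |G'| ≤ 8 Kmax q^{n(1-smin)} |G'| ≤ 8 Kmax |H|^{1 - smin/ℓ}`
  have hNpos : (0 : ℝ) < N := by exact_mod_cast (show 0 < N by omega)
  have hLNM : (L : ℝ) * N * M ≤ 8 * ((loCount q κ (d₀ / 2) : ℝ) * Fintype.card G') := by
    have h1 : ((L : ℝ) * N * M) * N ≤ (8 * ((loCount q κ (d₀ / 2) : ℝ) * Fintype.card G')) * N := by
      calc ((L : ℝ) * N * M) * N = (M : ℝ) * (L * (N : ℝ) ^ 2) := by ring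
        _ ≤ 8 * N * ((loCount q κ (d₀ / 2) : ℝ) * Fintype.card G') := hstep
        _ = (8 * ((loCount q κ (d₀ / 2) : ℝ) * Fintype.card G')) * N := by ring
    exact le_of_mul_le_mul_right h1 hNpos
  calc (L : ℝ) * (N : ℝ) * (M : ℝ) ≤ 8 * ((loCount q κ (d₀ / 2) : ℝ) * Fintype.card G') := hLNM
    _ ≤ 8 * (Kmax * (q : ℝ) ^ ((n : ℝ) * (1 - smin)) * Fintype.card G') := by
        have := mul_le_mul_of_nonneg_right hlo hGpos.le
        linarith
    _ = 8 * Kmax * ((q : ℝ) ^ ((n : ℝ) * (1 - smin)) * Fintype.card G') := by ring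
    _ ≤ 8 * Kmax * (Fintype.card H : ℝ) ^ (1 - smin / ℓ) :=
        mul_le_mul_of_nonneg_left hsave (by positivity)

/-! ### Glue, part 2 (PROVED): the crux from the Kronecker bound and the huge-block stub -/

open Summit.MatrixMultiplication.MatrixMultiplication.Theorems.ThinPackings.Negative
  (one_le_L two_le_M) in
open Summit.MatrixMultiplication.MatrixMultiplication.Theorems.RectangularThmB.Negative
  (succ_mul_sq_le_card) in
/-- **The composition** (kernel-checked, no `sorry` outside the three stubs): `RectangularThmB`
from STUB 1 (two-leg CLP/Kronecker inequality) and STUB 2 (quarter-point large deviation) — which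
together give the Kronecker bound `L·N·M ≤ c₀ |H|^{1-σ(ℓ)}` (`kroneckerBound_of`) and hence exclude
every near-tight family with `N < |H|^{σ/4}` in a group of more than `H₀ = c₀^{2/σ}` elements —
and STUB 3 (the huge-block regime `N ≥ |H|^{σ/4}`); groups of bounded order are dispatched by
the landed two-leg translate bound `(L+1)·N² ≤ |H|` (`Negative/TwoLegTranslate.lean`, p73858) and
Bernoulli's inequality.  The `η(ℓ,a)` produced is `min(η₀(ℓ), η_B(ℓ,a,σ/4), 1/(2H₀²), 1)`. -/
theorem RectangularThmB_of (h1 : Registered.stub_twoLegCLP) (h2 : Registered.stub_quarterRate)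
    (h3 : Registered.stub_hugeBlocks) :
    Summit.MatrixMultiplication.MatrixMultiplication.Theses.ThinBlockAlpha.RectangularThmB := by
  have hKB := kroneckerBound_of h1 h2
  intro ℓ a ha0 ha1
  obtain ⟨σ, hσ, c₀, hc₀, η₀, hη₀, hKBℓ⟩ := hKB ℓ
  -- stub 3 at the block exponent `ν = σ/4`
  obtain ⟨ηB, hηB, hB⟩ := h3 ℓ (σ / 4) (by positivity) a ha0 ha1
  -- threshold for the order of the group and the final `η`
  have hc₀pos : 0 < c₀ := by linarith
  set H₀ : ℝ := c₀ ^ (2 / σ) with hH₀def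
  have hH₀1 : 1 ≤ H₀ := Real.one_le_rpow hc₀ (by positivity)
  have hH₀pos : 0 < H₀ := by linarith
  set ηs : ℝ := 1 / (2 * H₀ ^ 2) with hηs
  have hηs0 : 0 < ηs := by positivity
  set η : ℝ := min (min η₀ ηB) (min ηs 1) with hηdef
  have hη0 : 0 < η := lt_min (lt_min hη₀ hηB) (lt_min hηs0 one_pos)
  have hηη₀ : η ≤ η₀ := (min_le_left _ _).trans (min_le_left _ _)
  have hηηB : η ≤ ηB := (min_le_left _ _).trans (min_le_right _ _)
  have hηηs : η ≤ ηs := (min_le_right _ _).trans (min_le_left _ _)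
  have hη1 : η ≤ 1 := (min_le_right _ _).trans (min_le_right _ _)
  refine ⟨η, hη0, ?_⟩
  intro H _ _ hexp L N M A B C hS hc hN hM
  by_contra hcon
  push Not at hcon
  -- basic positivity
  have hN1 : (1 : ℝ) ≤ N := by exact_mod_cast (show 1 ≤ N by omega)
  have hNpos : (0 : ℝ) < N := by linarith
  have hHpos : (0 : ℝ) < Fintype.card H := by exact_mod_cast Fintype.card_pos
  have hL := one_le_L hcon
  have hM2 := two_le_M hN ha0 hM
  have hNle : N ≤ Fintype.card H := (hc ⟨0, hL⟩).1 ▸ Finset.card_le_univ _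
  by_cases hν : (Fintype.card H : ℝ) ^ (σ / 4) ≤ N
  · -- HUGE BLOCKS: stub 3
    have hlt := hB H hexp L N M A B C hS hc hN hM hν
    have hmono : (L : ℝ) * (N : ℝ) ^ (2 + η) ≤ L * (N : ℝ) ^ (2 + ηB) :=
      mul_le_mul_of_nonneg_left (Real.rpow_le_rpow_of_exponent_le hN1 (by linarith))
        (Nat.cast_nonneg L)
    linarith
  push Not at hν
  -- SMALL BLOCKS: the Kronecker bound
  have hKr := hKBℓ η hη0.le hηη₀ H hexp L N M A B C hS hc hN hcon
  -- `|H|^σ ≤ c₀ N^{1+η-a}`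
  have hNa : (N : ℝ) ^ (1 + a) = N * (N : ℝ) ^ a := by
    rw [Real.rpow_add hNpos, Real.rpow_one]
  have hdag : (Fintype.card H : ℝ) * (N : ℝ) ^ (1 + a) ≤
      c₀ * (Fintype.card H : ℝ) ^ (1 - σ) * (N : ℝ) ^ (2 + η) := by
    calc (Fintype.card H : ℝ) * (N : ℝ) ^ (1 + a)
        ≤ (L : ℝ) * (N : ℝ) ^ (2 + η) * (N : ℝ) ^ (1 + a) :=
          mul_le_mul_of_nonneg_right hcon (Real.rpow_nonneg hNpos.le _)
      _ ≤ (L : ℝ) * (N : ℝ) ^ (2 + η) * (N * M) := by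
          apply mul_le_mul_of_nonneg_left _ (by positivity)
          rw [hNa]
          exact mul_le_mul_of_nonneg_left hM hNpos.le
      _ = ((L : ℝ) * N * M) * (N : ℝ) ^ (2 + η) := by ring
      _ ≤ c₀ * (Fintype.card H : ℝ) ^ (1 - σ) * (N : ℝ) ^ (2 + η) :=
          mul_le_mul_of_nonneg_right hKr (Real.rpow_nonneg hNpos.le _)
  have hHsplit : (Fintype.card H : ℝ) =
      (Fintype.card H : ℝ) ^ (1 - σ) * (Fintype.card H : ℝ) ^ σ := by
    rw [← Real.rpow_add hHpos]; ring_nf; exact (Real.rpow_one _).symm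
  have hNsplit : (N : ℝ) ^ (2 + η) = (N : ℝ) ^ (1 + a) * (N : ℝ) ^ (1 + η - a) := by
    rw [← Real.rpow_add hNpos]; ring_nf
  have hmain : (Fintype.card H : ℝ) ^ σ ≤ c₀ * (N : ℝ) ^ (1 + η - a) := by
    have hX : (0 : ℝ) < (Fintype.card H : ℝ) ^ (1 - σ) * (N : ℝ) ^ (1 + a) := by positivity
    refine le_of_mul_le_mul_left ?_ hX
    calc (Fintype.card H : ℝ) ^ (1 - σ) * (N : ℝ) ^ (1 + a) * (Fintype.card H : ℝ) ^ σ
        = (Fintype.card H : ℝ) * (N : ℝ) ^ (1 + a) := by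
          conv_rhs => rw [hHsplit]
          ring
      _ ≤ c₀ * (Fintype.card H : ℝ) ^ (1 - σ) * (N : ℝ) ^ (2 + η) := hdag
      _ = (Fintype.card H : ℝ) ^ (1 - σ) * (N : ℝ) ^ (1 + a) * (c₀ * (N : ℝ) ^ (1 + η - a)) := by
          rw [hNsplit]; ring
  -- `N^{1+η-a} ≤ N² < |H|^{σ/2}`, hence `|H|^{σ/2} ≤ c₀` and `|H| ≤ H₀`
  have hN2 : (N : ℝ) ^ (1 + η - a) ≤ (Fintype.card H : ℝ) ^ (σ / 2) := by
    calc (N : ℝ) ^ (1 + η - a) ≤ (N : ℝ) ^ (2 : ℝ) :=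
          Real.rpow_le_rpow_of_exponent_le hN1 (by linarith)
      _ ≤ ((Fintype.card H : ℝ) ^ (σ / 4)) ^ (2 : ℝ) :=
          Real.rpow_le_rpow hNpos.le hν.le (by norm_num)
      _ = (Fintype.card H : ℝ) ^ (σ / 2) := by
          rw [← Real.rpow_mul hHpos.le]; ring_nf
  have hHσ2 : (Fintype.card H : ℝ) ^ (σ / 2) ≤ c₀ := by
    have hY : (0 : ℝ) < (Fintype.card H : ℝ) ^ (σ / 2) := Real.rpow_pos_of_pos hHpos _
    refine le_of_mul_le_mul_left ?_ hY
    calc (Fintype.card H : ℝ) ^ (σ / 2) * (Fintype.card H : ℝ) ^ (σ / 2)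
        = (Fintype.card H : ℝ) ^ σ := by rw [← Real.rpow_add hHpos]; ring_nf
      _ ≤ c₀ * (N : ℝ) ^ (1 + η - a) := hmain
      _ ≤ c₀ * (Fintype.card H : ℝ) ^ (σ / 2) := mul_le_mul_of_nonneg_left hN2 hc₀pos.le
      _ = (Fintype.card H : ℝ) ^ (σ / 2) * c₀ := mul_comm _ _
  have hHle : (Fintype.card H : ℝ) ≤ H₀ := by
    have h1 := Real.rpow_le_rpow (Real.rpow_nonneg hHpos.le _) hHσ2
      (by positivity : (0 : ℝ) ≤ 2 / σ)
    rwa [← Real.rpow_mul hHpos.le, show σ / 2 * (2 / σ) = 1 by field_simp, Real.rpow_one] at h1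
  -- BOUNDED GROUPS: the two-leg translate bound `(L+1) N² ≤ |H|` and Bernoulli
  have hsucc := succ_mul_sq_le_card hS hc hM2 (by omega : 0 < L)
  have hsuccR : ((L : ℝ) + 1) * (N : ℝ) ^ 2 ≤ Fintype.card H := by exact_mod_cast hsucc
  have hsplit2 : (N : ℝ) ^ (2 + η) = (N : ℝ) ^ 2 * (N : ℝ) ^ η := by
    rw [Real.rpow_add hNpos, Real.rpow_two]
  have hLη : (L : ℝ) + 1 ≤ L * (N : ℝ) ^ η := by
    have h1 : ((L : ℝ) + 1) * (N : ℝ) ^ 2 ≤ (L * (N : ℝ) ^ η) * (N : ℝ) ^ 2 := by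
      calc ((L : ℝ) + 1) * (N : ℝ) ^ 2 ≤ Fintype.card H := hsuccR
        _ ≤ L * (N : ℝ) ^ (2 + η) := hcon
        _ = (L * (N : ℝ) ^ η) * (N : ℝ) ^ 2 := by rw [hsplit2]; ring
    exact le_of_mul_le_mul_right h1 (by positivity)
  have hLpos : (0 : ℝ) < L := by exact_mod_cast (show 0 < L by omega)
  have hLle : (L : ℝ) ≤ H₀ := by
    have h1 : L ≤ Fintype.card H := by
      calc L ≤ (L + 1) * 1 := by omega
        _ ≤ (L + 1) * N ^ 2 := Nat.mul_le_mul_left _ (Nat.one_le_pow _ _ (by omega))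
        _ ≤ Fintype.card H := hsucc
    have h2 : (L : ℝ) ≤ Fintype.card H := by exact_mod_cast h1
    exact h2.trans hHle
  have hlow : 1 + 1 / H₀ ≤ (N : ℝ) ^ η := by
    have h1 : 1 / H₀ ≤ 1 / (L : ℝ) := one_div_le_one_div_of_le hLpos hLle
    have h2 : 1 + 1 / (L : ℝ) ≤ (N : ℝ) ^ η := by
      rw [show 1 + 1 / (L : ℝ) = ((L : ℝ) + 1) / L by field_simp, div_le_iff₀ hLpos]
      linarith
    linarith
  have hNH₀ : (N : ℝ) ≤ H₀ := le_trans (by exact_mod_cast hNle) hHle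
  have hup : (N : ℝ) ^ η ≤ 1 + η * (H₀ - 1) := by
    have h1 : (N : ℝ) ^ η ≤ H₀ ^ η := Real.rpow_le_rpow hNpos.le hNH₀ hη0.le
    have h2 := rpow_one_add_le_one_add_mul_self (show (-1 : ℝ) ≤ H₀ - 1 by linarith) hη0.le hη1
    have e : (1 : ℝ) + (H₀ - 1) = H₀ := by ring
    rw [e] at h2
    exact h1.trans h2
  have hηH : η * (H₀ - 1) ≤ (H₀ - 1) / (2 * H₀ ^ 2) := by
    have h1 : η * (H₀ - 1) ≤ ηs * (H₀ - 1) := mul_le_mul_of_nonneg_right hηηs (by linarith)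
    have h2 : ηs * (H₀ - 1) = (H₀ - 1) / (2 * H₀ ^ 2) := by rw [hηs]; ring
    linarith
  have hfin : (H₀ - 1) / (2 * H₀ ^ 2) < 1 / H₀ := by
    rw [div_lt_div_iff₀ (by positivity) (by positivity)]
    nlinarith
  linarith

/-- Wiring check: the three registered stubs feed `RectangularThmB_of` as stated. -/
example : Summit.MatrixMultiplication.MatrixMultiplication.Theses.ThinBlockAlpha.RectangularThmB :=
  RectangularThmB_of stub_twoLegCLP stub_quarterRate stub_hugeBlocks

/-- The `a`-free by-product, wired to the stubs: the Kronecker bound for near-tight families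
(lands as a theorem of its own once STUBS 1–2 are proved). -/
example : KroneckerBound := kroneckerBound_of stub_twoLegCLP stub_quarterRate

end

end Summit.MatrixMultiplication.MatrixMultiplication.Cruxes.RectangularThmB.KroneckerMultiplicityClp
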